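import Summits.Ventures.PercRepro.ProfilePointedAverage

/-!
# PercRepro — THE POINTED CONJECTURE (Ĉ) HOLDS AT EVERY COLOOP (p10, gen 13; `proofs/P10-AVFULL.md` §21)

`PointedRow` (ProfilePointedAverage) is the pointed conjecture (Ĉ): `(N − k − 1)·P_k ≤ k·P_{k+1} + (N − 2k − 1)·c^p_k`
for `2k + 2 ≤ N`, with `c^p_k = extCount M k p`.  At a COLOOP `p` (`ρ(E ∖ p) + 1 = ρ(E)`, the lane's convention) the
bi-independent `k`-sets of `M` split by `p ∈ X` into `BI_k(M ∖ p)` and `BI_{k−1}(M ∖ p)` (`card_biIndepSets_coloop`),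
and every bi-independent set avoiding `p` extends by `p` (`extCount_coloop`: `c^p_k = P_k(M ∖ p)`), so (Ĉ) reads
`(n − k)·Q_{k−1} ≤ k·Q_{k+1}` for the profile `Q` of `M ∖ p` on `n = N − 1` elements — the two-step Theorem A
(`pointedRow_coloop_of_fact`, CONDITIONAL on the named fact `BiIndepDensityLogConcave`; everything else unconditional).
Together with `pointedRow_of_le_extCount` (the automatic regime) and the parallel-pair case (paper, §20(4)) this is the
«extreme cases» sanity check of (Ĉ); nothing here asserts (Ĉ).
-/

open scoped Matroid

namespace PercRepro.Cogirth

open Finset ThmH Skew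

variable {α : Type} [DecidableEq α] {M : Matroid α} [M.Finite]

/-- A coloop `p` (`ρ(E ∖ p) + 1 = ρ(E)`) lies in the closure of no set avoiding it. -/
theorem notMem_clF_of_coloop' {p : α} (hp : p ∈ gr M) (hpc : rk M ((gr M).erase p) + 1 = rk M (gr M))
    {X : Finset α} (hX : X ⊆ gr M) (hpX : p ∉ X) : p ∉ clF M X := by
  intro h
  have h' : p ∈ clF M ((gr M).erase p) :=
    clF_mono_sub (fun x hx => mem_erase.2 ⟨fun hxp => hpX (by rw [← hxp]; exact hx), hX hx⟩) h
  rw [mem_clF_iff_rk_insert_eq hp (erase_subset _ _), insert_erase hp] at h'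
  omega

/-- Adding a coloop raises the rank by one. -/
theorem rk_insert_of_coloop' {p : α} (hp : p ∈ gr M) (hpc : rk M ((gr M).erase p) + 1 = rk M (gr M))
    {X : Finset α} (hX : X ⊆ gr M) (hpX : p ∉ X) : rk M (insert p X) = rk M X + 1 := by
  rw [rk_insert_eq hp hX, if_neg (notMem_clF_of_coloop' hp hpc hX hpX)]

/-- For a coloop `p`, the bi-independent `k`-sets of `M` avoiding `p` are exactly those of `M ∖ p`. -/
theorem filter_biIndepSets_notMem_coloop {p : α} (hp : p ∈ gr M)
    (hpc : rk M ((gr M).erase p) + 1 = rk M (gr M)) (k : ℕ) :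
    (biIndepSets M k).filter (fun X => p ∉ X) = biIndepSets (M ＼ ({p} : Set α)) k := by
  ext X
  rw [mem_filter, mem_biIndepSets, mem_biIndepSets, gr_delete']
  constructor
  · rintro ⟨⟨hXg, hXk, hXr, hXc⟩, hpX⟩
    have hXg' : X ⊆ (gr M).erase p := fun x hx => mem_erase.2 ⟨fun h => hpX (h ▸ hx), hXg hx⟩
    have hpZ : p ∈ gr M \ X := mem_sdiff.2 ⟨hp, hpX⟩
    refine ⟨hXg', hXk, by rw [rk_delete hXg']; exact hXr, ?_⟩
    rw [rk_delete sdiff_subset, erase_sdiff]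
    have h := rk_insert_of_coloop' hp hpc (X := (gr M \ X).erase p)
      ((erase_subset _ _).trans sdiff_subset) (notMem_erase _ _)
    have hc := card_erase_add_one hpZ
    rw [insert_erase hpZ, hXc] at h
    omega
  · rintro ⟨hXg', hXk, hXr, hXc⟩
    have hpX : p ∉ X := fun h => (mem_erase.1 (hXg' h)).1 rfl
    have hXg : X ⊆ gr M := fun x hx => (mem_erase.1 (hXg' hx)).2
    have hpZ : p ∈ gr M \ X := mem_sdiff.2 ⟨hp, hpX⟩
    rw [rk_delete hXg'] at hXr
    rw [rk_delete sdiff_subset, erase_sdiff] at hXc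
    refine ⟨⟨hXg, hXk, hXr, ?_⟩, hpX⟩
    have h := rk_insert_of_coloop' hp hpc (X := (gr M \ X).erase p)
      ((erase_subset _ _).trans sdiff_subset) (notMem_erase _ _)
    have hc := card_erase_add_one hpZ
    rw [insert_erase hpZ, hXc] at h
    omega

/-- For a coloop `p`, the bi-independent `k`-sets of `M` containing `p` are `BI_{k−1}(M ∖ p)` plus `p`. -/
theorem card_filter_biIndepSets_mem_coloop {p : α} (hp : p ∈ gr M)
    (hpc : rk M ((gr M).erase p) + 1 = rk M (gr M)) {k : ℕ} (hk : 1 ≤ k) :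
    ((biIndepSets M k).filter (fun X => p ∈ X)).card = (biIndepSets (M ＼ ({p} : Set α)) (k - 1)).card := by
  apply card_bij (fun X _ => X.erase p)
  · intro X hX
    rw [mem_filter, mem_biIndepSets] at hX
    obtain ⟨⟨hXg, hXk, hXr, hXc⟩, hpX⟩ := hX
    rw [mem_biIndepSets, gr_delete']
    have hXg' : X.erase p ⊆ (gr M).erase p := erase_subset_erase p hXg
    refine ⟨hXg', by rw [card_erase_of_mem hpX, hXk], ?_, ?_⟩
    · rw [rk_delete hXg']
      have h := rk_insert_of_coloop' hp hpc ((erase_subset _ _).trans hXg) (notMem_erase p X)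
      rw [insert_erase hpX, hXr] at h
      rw [card_erase_of_mem hpX]
      omega
    · rw [rk_delete sdiff_subset]
      have e : (gr M).erase p \ X.erase p = gr M \ X := by
        ext x
        simp only [mem_sdiff, mem_erase]
        constructor
        · rintro ⟨⟨hxp, hx⟩, hxX⟩
          exact ⟨hx, fun h => hxX ⟨hxp, h⟩⟩
        · rintro ⟨hx, hxX⟩
          exact ⟨⟨fun h => hxX (h ▸ hpX), hx⟩, fun h => hxX h.2⟩
      rw [e]
      exact hXc
  · intro X hX Y hY h
    rw [mem_filter] at hX hY
    rw [← insert_erase hX.2, ← insert_erase hY.2, h]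
  · intro Y hY
    rw [mem_biIndepSets, gr_delete'] at hY
    obtain ⟨hYg', hYk, hYr, hYc⟩ := hY
    have hpY : p ∉ Y := fun h => (mem_erase.1 (hYg' h)).1 rfl
    have hYg : Y ⊆ gr M := fun x hx => (mem_erase.1 (hYg' hx)).2
    refine ⟨insert p Y, ?_, erase_insert hpY⟩
    rw [mem_filter, mem_biIndepSets]
    refine ⟨⟨insert_subset hp hYg, by rw [card_insert_of_notMem hpY, hYk]; omega, ?_, ?_⟩,
      mem_insert_self _ _⟩
    · rw [rk_insert_of_coloop' hp hpc hYg hpY, card_insert_of_notMem hpY, ← rk_delete hYg', hYr]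
    · rw [rk_delete sdiff_subset] at hYc
      have e : gr M \ insert p Y = (gr M).erase p \ Y := by
        ext x
        simp only [mem_sdiff, mem_insert, mem_erase, not_or]
        tauto
      rw [e]
      exact hYc

/-- **The bi-independent profile at a coloop**: `P_k(M) = P_k(M ∖ p) + P_{k−1}(M ∖ p)` for `k ≥ 1`. -/
theorem card_biIndepSets_coloop {p : α} (hp : p ∈ gr M) (hpc : rk M ((gr M).erase p) + 1 = rk M (gr M))
    {k : ℕ} (hk : 1 ≤ k) :
    (biIndepSets M k).card =
      (biIndepSets (M ＼ ({p} : Set α)) k).card + (biIndepSets (M ＼ ({p} : Set α)) (k - 1)).card := by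
  rw [← card_filter_add_card_filter_not (s := biIndepSets M k) (fun X => p ∉ X),
    filter_biIndepSets_notMem_coloop hp hpc k, ← card_filter_biIndepSets_mem_coloop hp hpc hk]
  congr 2
  ext X
  simp only [mem_filter, not_not]

/-- **`c^p_k = P_k(M ∖ p)` at a coloop**: every bi-independent set avoiding the coloop extends by it. -/
theorem extCount_coloop {p : α} (hp : p ∈ gr M) (hpc : rk M ((gr M).erase p) + 1 = rk M (gr M)) (k : ℕ) :
    extCount M k p = (biIndepSets (M ＼ ({p} : Set α)) k).card := by
  unfold extCount
  rw [← filter_biIndepSets_notMem_coloop hp hpc k]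
  congr 1
  ext X
  simp only [mem_filter]
  constructor
  · rintro ⟨hX, hpX, -⟩
    exact ⟨hX, hpX⟩
  · rintro ⟨hX, hpX⟩
    refine ⟨hX, hpX, ?_⟩
    rw [insert_mem_biIndepSets_iff hX hp hpX]
    exact notMem_clF_of_coloop' hp hpc (mem_biIndepSets.1 hX).1 hpX

/-- Level `0` of (Ĉ) at a coloop: `P_0(M) = P_0(M ∖ p)` (no bi-independent `0`-set contains `p`). -/
theorem card_biIndepSets_zero_coloop {p : α} (hp : p ∈ gr M)
    (hpc : rk M ((gr M).erase p) + 1 = rk M (gr M)) :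
    (biIndepSets M 0).card = (biIndepSets (M ＼ ({p} : Set α)) 0).card := by
  rw [← filter_biIndepSets_notMem_coloop hp hpc 0]
  congr 1
  ext X
  simp only [mem_filter]
  constructor
  · intro hX
    refine ⟨hX, ?_⟩
    rw [mem_biIndepSets] at hX
    rw [card_eq_zero.1 hX.2.1]
    exact notMem_empty p
  · exact fun h => h.1

/-- **THE POINTED CONJECTURE (Ĉ) HOLDS AT EVERY COLOOP** (CONDITIONAL on the named fact): for a coloop `p` and
`2k + 2 ≤ N`, `(N − k − 1)·P_k ≤ k·P_{k+1} + (N − 2k − 1)·c^p_k` — it is the two-step Theorem A for `M ∖ p`. -/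
theorem pointedRow_coloop_of_fact (hfact : BiIndepDensityLogConcave α) (M : Matroid α) [M.Finite] {p : α}
    (hp : p ∈ gr M) (hpc : rk M ((gr M).erase p) + 1 = rk M (gr M)) (k : ℕ)
    (hk : 2 * k + 2 ≤ (gr M).card) :
    ((gr M).card - k - 1) * (biIndepSets M k).card ≤
      k * (biIndepSets M (k + 1)).card + ((gr M).card - 2 * k - 1) * extCount M k p := by
  have hN : (gr (M ＼ ({p} : Set α))).card = (gr M).card - 1 := by
    rw [gr_delete', card_erase_of_mem hp]
  rw [extCount_coloop hp hpc k]
  rcases Nat.eq_zero_or_pos k with rfl | hk1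
  · rw [card_biIndepSets_zero_coloop hp hpc]
    simp only [zero_mul, zero_add, Nat.sub_zero, Nat.mul_zero, le_refl]
  · rw [card_biIndepSets_coloop hp hpc hk1, card_biIndepSets_coloop hp hpc (by omega : 1 ≤ k + 1),
      show k + 1 - 1 = k by omega]
    obtain ⟨m, hm⟩ := Nat.exists_eq_add_of_le hk
    have hA1 := biIndepDensity_mono_of_fact hfact (M ＼ ({p} : Set α)) (k - 1) (by rw [hN]; omega)
    rw [hN, show k - 1 + 1 = k by omega, hm, show 2 * k + 2 + m - 1 - (k - 1) = k + 2 + m by omega] at hA1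
    have hA2 : (k + 1 + m) * (biIndepSets (M ＼ ({p} : Set α)) k).card ≤
        (k + 1) * (biIndepSets (M ＼ ({p} : Set α)) (k + 1)).card := by
      rcases Nat.eq_zero_or_pos m with rfl | hm1
      · have hs := card_biIndepSets_symm (M ＼ ({p} : Set α)) (k := k) (by rw [hN]; omega)
        rw [hN, hm, show 2 * k + 2 + 0 - 1 - k = k + 1 by omega] at hs
        rw [hs]
      · have h := biIndepDensity_mono_of_fact hfact (M ＼ ({p} : Set α)) k (by rw [hN]; omega)
        rw [hN, hm, show 2 * k + 2 + m - 1 - k = k + 1 + m by omega] at h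
        exact h
    rw [hm, show 2 * k + 2 + m - k - 1 = k + 1 + m by omega,
      show 2 * k + 2 + m - 2 * k - 1 = m + 1 by omega]
    generalize (biIndepSets (M ＼ ({p} : Set α)) (k - 1)).card = Q0 at hA1 ⊢
    generalize (biIndepSets (M ＼ ({p} : Set α)) k).card = Q1 at hA1 hA2 ⊢
    generalize (biIndepSets (M ＼ ({p} : Set α)) (k + 1)).card = Q2 at hA2 ⊢
    have key : (k + 1 + m) * Q0 ≤ k * Q2 := by
      apply Nat.le_of_mul_le_mul_left (c := k + 2 + m) _ (by omega)
      calc (k + 2 + m) * ((k + 1 + m) * Q0) = (k + 1 + m) * ((k + 2 + m) * Q0) := by ring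
        _ ≤ (k + 1 + m) * (k * Q1) := Nat.mul_le_mul_left _ hA1
        _ = k * ((k + 1 + m) * Q1) := by ring
        _ ≤ k * ((k + 1) * Q2) := Nat.mul_le_mul_left _ hA2
        _ ≤ (k + 2 + m) * (k * Q2) := by
            rw [show (k + 2 + m) * (k * Q2) = k * ((k + 2 + m) * Q2) by ring]
            exact Nat.mul_le_mul_left _ (Nat.mul_le_mul_right _ (by omega))
    nlinarith [key]

end PercRepro.Cogirth
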